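import Literature.Probability.Percolation.TriUQuadScaleGood
import Literature.Probability.Percolation.MultiscaleSum
import Literature.Probability.Percolation.HalfPlaneArmsUQuad
import Literature.Probability.Percolation.TriUQuadRSW
import HarnessLib

/-!
# The half-plane two-arm probability at two radii: `P ≤ C m / n`

Topic `Literature/Probability/Percolation`; family `crit-perc`, statement **crit-perc.S16**
(`Literature.Probability.Percolation.triTheta_exponent`). The discharge of the named fact
`Nolin2008_halfPlane_twoArm` (`HalfPlaneArmEvents.lean`): at `p = 1/2`, for all `n₀ ≤ m ≤ n`,
`P(two arms of prescribed colours in the upper half-plane from ∂S_m to ∂S_n) ≤ C m / n`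
(P. Nolin, EJP 13 (2008), Thm. 24 (i) with Prop. 17 and §4.6; W. Werner, PCMI Lecture 2, first
exercise sheet, "Two-arm exponent in the half-plane", 3; H. Kesten, CMP 109 (1987), Lemma 4).

Proof (Kesten's inner separation, simplified by the real line): by colour switching
(`HalfPlaneArmsUQuad.lean`) it suffices to bound the probability of an open and a closed crossing
of the U-shaped half-annulus `U_{k,N}`. At each scale `s_j = 3^j k`, `j < J ≍ log₃(N/k)`, either
the trimmed good event `Gsc` of `TriUQuadScaleGood.lean` fails (probability `≤ 1/6`, independently
over `j`), or (`TriUQuadScale.lean`) the two crossings yield a window point `(x₀, 0)`,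
`|x₀| ≤ 2 s_j`, which is good for `ω` or for `ωᶜ` at scale `N/2` — an event of probability
`≤ C s_j / N` (`real_hpGood_le_div`, `HalfPlaneTwoArmPoint.lean`). Summing the geometric series
(`MultiscaleSum.lean`) gives `C k / N`.

* `radiiL`, `radiiM₁`, `radiiA`, `radiiM₀`, `radii_params` — the scale parameters and their
  arithmetic;
* `shellFin`, `dFin`, disjointness across scales;
* `real_armTwo_le` — `P(open and closed crossings of U_{k,2M'}) ≤ C k / M'`;
* `Nolin2008_halfPlane_twoArm_holds` — the discharge.

## References

* P. Nolin, Near-critical percolation in two dimensions, *Electron. J. Probab.* 13 (2008),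
  Thm. 24 (i), Prop. 17, §4.4–§4.6 [arXiv 0711.4948: Thm. 23 (i), Prop. 16] [Nolin2008].
* H. Kesten, Scaling relations for 2D-percolation, *Comm. Math. Phys.* 109 (1987), Lemma 4
  [KestenScalingCMP1987].
* W. Werner, Lectures on two-dimensional critical percolation (2009), Lecture 2, first exercise
  sheet [WernerPCMI2009].
* S. Smirnov, W. Werner, Critical exponents for two-dimensional percolation, *Math. Res. Lett.* 8
  (2001), Thm. 3 (the half-plane exponents as input to the derivative estimates) [SmirnovWernerMRL2001].

## Mathlib / tree

Tree: `Gsc`, `good_subset_gsc`, `armEv_inter_gsc_subset`, `determinedBy_gsc`, `shell`,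
`armEv_mono_inner`, `determinedBy_armEv` (`TriUQuadScaleGood.lean`), `real_zev_aev_le`, `uQ`,
`uInnerFinset`, `coe_uInnerFinset` (`TriUQuadScale.lean`), `real_le_sum_firstGood`
(`MultiscaleSum.lean`), `TriQuad.real_not_good_le` (`TriQuadGoodEvent.lean`),
`real_uLRPath_half_le` (`TriUQuadRSW.lean`), `real_domArmEvent_two_le` (`HalfPlaneArmsUQuad.lean`),
`real_hpGood_le_div`, `le_triLRCrossingProb_long_of_rhombus` (`HalfPlaneTwoArmPoint.lean`),
`triLRCrossingProb_half_self`, `triLRCrossingProb_anti_width`. Mathlib: `exists_pow_lt_of_lt_one`.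
-/

noncomputable section

open Set MeasureTheory

namespace Literature.Probability.Percolation

open LatticeModels

/-! ### The scale parameters -/

/-- The ratio constant `L = 2 · 3^{K-1} (4 · 3^{K'-1} + 8)`. [folklore] -/
def radiiL (K K' : ℕ) : ℕ := 2 * 3 ^ (K - 1) * (4 * 3 ^ (K' - 1) + 8)

/-- The smallest fence-frame scale (and band width) `M₁ = s / L`. [folklore] -/
def radiiM₁ (K K' s : ℕ) : ℕ := s / radiiL K K'

/-- The reach `A = 2 · 3^{K'-1} M₁` of the fence frames. [folklore] -/
def radiiA (K K' s : ℕ) : ℕ := 2 * 3 ^ (K' - 1) * radiiM₁ K K' s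

/-- The tip-separation / smallest protection scale `M₀ = 2(A + M₁) + 2M₁ + 2`. [folklore] -/
def radiiM₀ (K K' s : ℕ) : ℕ := 2 * (radiiA K K' s + radiiM₁ K K' s) + 2 * radiiM₁ K K' s + 2

/-- **Arithmetic of the scale parameters** (`16 L ≤ s`). [folklore] -/
theorem radii_params {K K' s : ℕ} (hs : 16 * radiiL K K' ≤ s) :
    16 ≤ radiiM₁ K K' s ∧
      4 * radiiA K K' s + 2 * radiiM₁ K K' s + 8 ≤ s ∧
      2 * 3 ^ (K - 1) * radiiM₀ K K' s ≤ s ∧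
      radiiM₁ K K' s ≤ radiiA K K' s ∧
      2 * s ≤ 6 * radiiL K K' * (radiiM₁ K K' s - 1) ∧
      4 * radiiA K K' s ≤ s := by
  set X : ℕ := 3 ^ (K' - 1) with hX
  set Y : ℕ := 3 ^ (K - 1) with hY
  set L : ℕ := radiiL K K' with hL
  set M : ℕ := radiiM₁ K K' s with hM
  have hX1 : 1 ≤ X := Nat.one_le_pow _ _ (by norm_num)
  have hY1 : 1 ≤ Y := Nat.one_le_pow _ _ (by norm_num)
  have hLdef : L = 2 * Y * (4 * X + 8) := rfl
  have hL1 : 1 ≤ L := by rw [hLdef]; nlinarith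
  have hLpos : 0 < L := hL1
  have hML : M * L ≤ s := Nat.div_mul_le_self s L
  have hsML : s < M * L + L := Nat.lt_div_mul_add hLpos
  have hM16 : 16 ≤ M := (Nat.le_div_iff_mul_le hLpos).2 (by linarith)
  have hAdef : radiiA K K' s = 2 * X * M := rfl
  have hM₀def : radiiM₀ K K' s = 2 * (2 * X * M + M) + 2 * M + 2 := rfl
  -- products as atoms
  have hXM : M ≤ X * M := Nat.le_mul_of_pos_left _ hX1
  have hL16 : 8 * X + 16 ≤ L := by rw [hLdef]; nlinarith
  refine ⟨hM16, ?_, ?_, ?_, ?_, ?_⟩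
  · -- 4A + 2M + 8 ≤ (8X + 16) M ≤ L M ≤ s
    rw [hAdef]
    have h1 : 4 * (2 * X * M) + 2 * M + 8 ≤ (8 * X + 16) * M := by nlinarith
    have h2 : (8 * X + 16) * M ≤ L * M := Nat.mul_le_mul_right _ hL16
    nlinarith
  · -- 2Y M₀ ≤ 2Y (4X + 6) M ≤ L M ≤ s
    rw [hM₀def]
    have h1 : 2 * (2 * X * M + M) + 2 * M + 2 ≤ (4 * X + 6) * M := by nlinarith
    have h2 : 2 * Y * ((4 * X + 6) * M) ≤ L * M := by rw [hLdef]; nlinarith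
    calc 2 * Y * (2 * (2 * X * M + M) + 2 * M + 2) ≤ 2 * Y * ((4 * X + 6) * M) := Nat.mul_le_mul_left _ h1
      _ ≤ L * M := h2
      _ ≤ s := by rw [mul_comm]; exact hML
  · rw [hAdef]; nlinarith
  · -- 2s < 2(M+1)L ≤ 6L(M-1)
    have h1 : 6 * L * (M - 1) = 6 * (M * L) - 6 * L := by
      rw [Nat.mul_sub_one, mul_comm M L, mul_assoc]
    have h2 : 2 * L ≤ M * L := Nat.mul_le_mul_right _ (by omega)
    omega
  · -- 4A = 8 X M ≤ L M ≤ s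
    rw [hAdef]
    have : 8 * X * M ≤ L * M := Nat.mul_le_mul_right _ (by omega)
    nlinarith

/-! ### Shells as finite sets; disjointness across scales -/

open Classical in
/-- The shell of the scale as a finite set. [folklore] -/
def shellFin (s A : ℕ) : Finset (Site 2) :=
  uSites s (2 * s) ∪ (uInnerFinset s).filter fun z => z 0 ≤ -(s : ℤ) + A ∨ (s : ℤ) - A ≤ z 0 ∨ (s : ℤ) - A ≤ z 1

/-- Membership in the finite shell. [folklore] -/
theorem mem_shellFin_iff {s : ℕ} (hs : 1 ≤ s) (A : ℕ) {z : Site 2} : z ∈ shellFin s A ↔ z ∈ shell s A := by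
  have h1 : z ∈ uInnerFinset s ↔ z ∈ uInner s := by rw [← Finset.mem_coe, coe_uInnerFinset hs]
  simp only [shellFin, shell, Finset.mem_union, Finset.mem_filter, mem_union, Finset.mem_coe, mem_inter_iff,
    mem_setOf_eq, h1]

/-- The finite shell has underlying set `shell`. [folklore] -/
theorem coe_shellFin {s : ℕ} (hs : 1 ≤ s) (A : ℕ) : (↑(shellFin s A) : Set (Site 2)) = shell s A :=
  Set.ext fun _ => by rw [Finset.mem_coe]; exact mem_shellFin_iff hs A

/-- The finite set determining the two arms together with the trimmed good event. [folklore] -/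
def dFin (s N A : ℕ) : Finset (Site 2) := uSites s N ∪ shellFin s A

/-- The shell lies in the half-box `[-2s, 2s] × [0, 2s]`. [folklore] -/
theorem shell_subset_box {s A : ℕ} {z : Site 2} (hz : z ∈ shell s A) :
    -(2 * (s : ℤ)) ≤ z 0 ∧ z 0 ≤ 2 * s ∧ 0 ≤ z 1 ∧ z 1 ≤ 2 * s := by
  rcases hz with hz | ⟨hz, -⟩
  · have := (mem_coe_uSites.1 hz).1; push_cast at this; omega
  · have := mem_uInner.1 hz; omega

/-- **Disjointness across scales**: the shell of a scale `s'` misses the determining set of a scale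
`s` with `2s' + A + 1 ≤ s` (`s + 1 ≤ N`). [folklore] -/
theorem disjoint_shellFin_dFin {s' A' s N A : ℕ} (hs' : 1 ≤ s') (hs : 1 ≤ s) (h : 2 * s' + A + 1 ≤ s) :
    Disjoint (shellFin s' A') (dFin s N A) := by
  have h' : 2 * (s' : ℤ) + A + 1 ≤ s := by exact_mod_cast h
  rw [Finset.disjoint_left]
  intro z hz hz'
  have hb := shell_subset_box ((mem_shellFin_iff hs' A').1 hz)
  have hzI : z ∈ uInner s := by rw [mem_uInner]; omega
  rw [dFin, Finset.mem_union] at hz'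
  rcases hz' with hz' | hz'
  · exact (mem_coe_uSites.1 (Finset.mem_coe.2 hz')).2 hzI
  · rcases (mem_shellFin_iff hs A).1 hz' with hz'' | ⟨-, hz''⟩
    · exact (mem_coe_uSites.1 hz'').2 hzI
    · simp only [mem_setOf_eq] at hz''
      omega

/-- Disjointness of the shells of two scales. [folklore] -/
theorem disjoint_shellFin_shellFin {s' A' s A : ℕ} (hs' : 1 ≤ s') (hs : 1 ≤ s) (h : 2 * s' + A + 1 ≤ s) :
    Disjoint (shellFin s' A') (shellFin s A) :=
  Finset.disjoint_of_subset_right (Finset.subset_union_right (s₁ := uSites s (2 * s)))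
    (disjoint_shellFin_dFin (N := 2 * s) hs' hs h)

/-- Locality of the two arms together with the trimmed good event. [folklore] -/
theorem determinedBy_armTwo_gsc {s N : ℕ} (hs : 1 ≤ s) {T K M₀ K' M₁ A : ℕ} (hA : 2 * 3 ^ (K' - 1) * M₁ ≤ A) :
    DeterminedBy ((armEv s N ∩ compl ⁻¹' armEv s N) ∩ Gsc s hs T K M₀ K' M₁) ↑(dFin s N A) := by
  rw [dFin, Finset.coe_union, coe_shellFin hs]
  exact (((determinedBy_armEv s N).inter (determinedBy_compl_mem (determinedBy_armEv s N))).mono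
    subset_union_left).inter ((determinedBy_gsc hA).mono subset_union_right)

/-! ### Constants at `p = 1/2` -/

/-- **RSW input at `1/2`**: a constant `c₀ ∈ (0, 1]` below the long-way crossing probabilities
`P_{1/2}(LR(4k, k))`, `k ≥ 15` (`le_triLRCrossingProb_long_of_rhombus`, the rhombi being crossed
with probability `1/2`). [cite: WernerPCMI2009, Lecture 2 (RSW)] -/
theorem exists_rsw_long_half :
    ∃ c₀ : ℝ, 0 < c₀ ∧ c₀ ≤ 1 ∧ ∀ k : ℕ, 15 ≤ k → c₀ ≤ triLRCrossingProb half (4 * k) k := by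
  obtain ⟨c₀, hc₀⟩ : ∃ c₀ : ℝ, c₀ = (((1 / 4 : ℝ) / 2) ^ 396) ^ 4 * (1 / 4) ^ 3 := ⟨_, rfl⟩
  have hc₀0 : 0 < c₀ := by rw [hc₀]; positivity
  have hr : ∀ k : ℕ, 15 ≤ k → c₀ ≤ triLRCrossingProb half (4 * k) k := fun k hk => by
    rw [hc₀]
    exact le_triLRCrossingProb_long_of_rhombus half (by norm_num) hk fun m _ => by
      rw [triLRCrossingProb_half_self]; norm_num
  clear hc₀
  exact ⟨c₀, hc₀0, (hr 15 le_rfl).trans (triLRCrossingProb_mem_Icc _ _ _).2, hr⟩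

/-! ### One scale at `p = 1/2` -/

section OneScale

variable {T K s : ℕ}

/-- **The trimmed good event fails with probability at most `1/6`** once `T` and `K` are chosen
with `2 (1 - c_q)^T ≤ 1/12` and `8 T (1 - c₀⁴)^K ≤ 1/12` (`c_q` the constant of
`real_uLRPath_half_le`, `c₀` that of `exists_rsw_long_half`), for every scale `s ≥ 16 L`. [cite: Nolin2008, §4.4, proof of Lemma 15 (arXiv 0711.4948: Lemma 14)] -/
theorem real_compl_gsc_le (hs1 : 1 ≤ s) (hs : 16 * radiiL K K ≤ s) {c₀ cq : ℝ} (hc₀ : 0 < c₀) (hc₀1 : c₀ ≤ 1)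
    (hrsw : ∀ k : ℕ, 15 ≤ k → c₀ ≤ triLRCrossingProb half (4 * k) k)
    (hq : ∀ (k : ℕ) (hk : 15 ≤ k) (hkN : k + 1 ≤ 2 * k),
      (triSitePercolation half).real {ω | (uQuad k (2 * k) (le_trans (by norm_num) hk) hkN).LRPath ω} ≤ 1 - cq)
    (hT : 2 * (1 - cq) ^ T ≤ 1 / 12) (hK : 8 * T * (1 - c₀ ^ 4) ^ K ≤ 1 / 12) :
    (triSitePercolation half).real (Gsc s hs1 T K (radiiM₀ K K s) K (radiiM₁ K K s))ᶜ ≤ 1 / 6 := by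
  have hL0 : 0 < radiiL K K := by unfold radiiL; positivity
  have hs15 : 15 ≤ s := by nlinarith
  obtain ⟨hM16, -, -, hMA, -, -⟩ := radii_params hs
  set M₁ := radiiM₁ K K s
  set M₀ := radiiM₀ K K s
  have hM₀15 : 15 ≤ M₀ := by show 15 ≤ 2 * (radiiA K K s + M₁) + 2 * M₁ + 2; omega
  have hcq1 : cq ≤ 1 := by
    have := hq 15 le_rfl (by norm_num)
    linarith [measureReal_nonneg (μ := triSitePercolation half)
      (s := {ω | (uQuad 15 (2 * 15) (le_trans (by norm_num) (le_refl 15)) (by norm_num)).LRPath ω})]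
  have hframe : ∀ (M : ℕ), 15 ≤ M → ∀ i : ℕ, c₀ ≤ triLRCrossingProb half (4 * (3 ^ i * M)) (3 ^ i * M) := by
    intro M hM i
    exact hrsw _ (le_trans hM (Nat.le_mul_of_pos_left _ (Nat.one_le_pow _ _ (by norm_num))))
  calc (triSitePercolation half).real (Gsc s hs1 T K M₀ K M₁)ᶜ
      ≤ (triSitePercolation half).real {ω | ¬ (uQ s hs1).Good T K M₀ K M₁ (uInner s) ω} :=
        measureReal_mono (compl_subset_comm.1 fun ω hω => good_subset_gsc T K M₀ K M₁ (by simpa using hω))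
          (measure_ne_top _ _)
    _ ≤ _ := TriQuad.real_not_good_le half T K (by omega) K (by omega) (uInner s) hc₀.le hc₀1 hc₀.le hc₀1
          (fun i _ => hframe M₀ hM₀15 i) (fun i _ => hframe M₁ (by omega) i)
          (fun i _ => by rw [symm_half]; exact hframe M₀ hM₀15 i)
          (fun i _ => by rw [symm_half]; exact hframe M₁ (by omega) i)
    _ ≤ 1 / 6 := by
        rw [symm_half]
        have hLR : (triSitePercolation half).real {ξ | (uQ s hs1).LRPath ξ} ≤ 1 - cq := hq s hs15 (by omega)
        have h0 : 0 ≤ (triSitePercolation half).real {ξ | (uQ s hs1).LRPath ξ} := measureReal_nonneg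
        have hpow : (triSitePercolation half).real {ξ | (uQ s hs1).LRPath ξ} ^ T ≤ (1 - cq) ^ T :=
          pow_le_pow_left₀ h0 hLR T
        nlinarith [hpow, hT, hK]

/-- **The two arms and the trimmed good event, one scale** (`16 L ≤ s`, `4 s ≤ M'`, `N = 2M'`):
`P ≤ (10 C_g / c_B) · s / M'`, where `C_g` bounds `M' · P_{1/2}(0 is M'-good)` and `c_B` is the band
constant of the scale parameters. [cite: Nolin2008, §4.5, proof of Prop. 17 (arXiv 0711.4948: Prop. 16)] [cite: KestenScalingCMP1987, Lemma 4] -/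
theorem real_armTwo_gsc_le (hs1 : 1 ≤ s) (hs : 16 * radiiL K K ≤ s) {M' N : ℕ} (hNM : N = 2 * M') (hsM : 4 * s ≤ M')
    {c₀ Cg : ℝ} (hc₀ : 0 < c₀) (hrsw : ∀ k : ℕ, 15 ≤ k → c₀ ≤ triLRCrossingProb half (4 * k) k)
    (hCg : ∀ n : ℕ, 1 ≤ n → (triSitePercolation half).real (hpGood n 0) ≤ Cg / n) :
    (triSitePercolation half).real
        ((armEv s N ∩ compl ⁻¹' armEv s N) ∩ Gsc s hs1 T K (radiiM₀ K K s) K (radiiM₁ K K s)) ≤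
      10 * Cg / ((c₀ ^ (6 * radiiL K K - 1) * (1 / 2 : ℝ) ^ (6 * radiiL K K - 1 - 1)) ^ 3) ^ 2 * s / M' := by
  obtain ⟨hM16, hsA, hKM₀, hMA, hjs, h4A⟩ := radii_params hs
  set L := radiiL K K with hL
  set M₁ := radiiM₁ K K s
  set A := radiiA K K s
  set M₀ := radiiM₀ K K s
  have hL0 : 0 < L := by rw [hL]; unfold radiiL; positivity
  have hL1 : 1 ≤ L := hL0
  set j : ℕ := 6 * L - 1 with hj
  set h : ℕ := M₁ - 1 with hh
  have hh15 : 15 ≤ h := by omega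
  set ε : ℝ := (c₀ ^ j * (1 / 2 : ℝ) ^ (j - 1)) ^ 3 with hε
  have hε0 : 0 < ε := by positivity
  -- RSW inputs for the band
  have h₁ : c₀ ≤ triLRCrossingProb half (2 * h) h :=
    (hrsw h hh15).trans (triLRCrossingProb_anti_width half (by omega) h)
  have h₂ : (1 / 2 : ℝ) ≤ triLRCrossingProb half h h := by rw [triLRCrossingProb_half_self]
  have hM'1 : 1 ≤ M' := by omega
  have hgood := hCg M' hM'1
  have h₁' : c₀ ≤ triLRCrossingProb (unitInterval.symm half) (2 * h) h := by rw [symm_half]; exact h₁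
  have h₂' : (1 / 2 : ℝ) ≤ triLRCrossingProb (unitInterval.symm half) h h := by rw [symm_half]; exact h₂
  have hj1 : 1 ≤ j := by omega
  have hWh : M₁ = h + 1 := by omega
  have hjs' : 2 * s ≤ (j + 1) * h := by
    have : j + 1 = 6 * L := by omega
    rw [this]; exact hjs
  have key := real_zev_aev_le (hs := hs1) (N := N) (T := T) (K := K) (M₀ := M₀) (K' := K) (M₁ := M₁) (W := M₁)
    (A := A) (h := h) (j := j) (M' := M') (δ₁ := c₀) (δ₂ := 1 / 2) (δ₁' := c₀) (δ₂' := 1 / 2) half hc₀.le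
    (by norm_num) h₁ h₂ hc₀.le (by norm_num) h₁' h₂' hj1 hWh hjs' (by omega) le_rfl hMA le_rfl le_rfl hsA
    (by omega) hKM₀ hNM (by omega)
  rw [symm_half] at key
  have hsub := armEv_inter_gsc_subset (hs := hs1) (N := N) (by omega) T K M₀ K M₁
  have hP := measureReal_mono hsub (measure_ne_top (triSitePercolation half) _)
  -- `ε² P ≤ (2(s+A)+1) · 2 C_g / M' ≤ 10 s C_g / M'`
  have hM'0 : (0 : ℝ) < M' := by exact_mod_cast hM'1
  have hsA' : (A : ℝ) ≤ s := by exact_mod_cast (by omega : A ≤ s)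
  have hs1' : (1 : ℝ) ≤ s := by exact_mod_cast hs1
  have hg0 : 0 ≤ (triSitePercolation half).real (hpGood M' 0) := measureReal_nonneg
  have hrhs : (2 * ((s : ℝ) + A) + 1) * ((triSitePercolation half).real (hpGood M' 0) +
      (triSitePercolation half).real (hpGood M' 0)) ≤ 10 * Cg * s / M' := by
    have h5 : 2 * ((s : ℝ) + A) + 1 ≤ 5 * s := by linarith
    have hsum : (triSitePercolation half).real (hpGood M' 0) + (triSitePercolation half).real (hpGood M' 0) ≤
        2 * (Cg / M') := by linarith
    calc (2 * ((s : ℝ) + A) + 1) * ((triSitePercolation half).real (hpGood M' 0) +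
          (triSitePercolation half).real (hpGood M' 0))
        ≤ 5 * s * (2 * (Cg / M')) := mul_le_mul h5 hsum (by linarith) (by linarith)
      _ = 10 * Cg * s / M' := by ring
  set PG := (triSitePercolation half).real ((armEv s N ∩ compl ⁻¹' armEv s N) ∩ Gsc s hs1 T K M₀ K M₁) with hPG
  have e1 : ε ^ 2 * PG ≤ ε ^ 2 * (triSitePercolation half).real
      (Zev s N hs1 T K M₀ ∩ {ω | ω ∈ Aev s N hs1 K M₁ ω}) := mul_le_mul_of_nonneg_left hP (by positivity)
  have e2 : ε ^ 2 * (triSitePercolation half).real (Zev s N hs1 T K M₀ ∩ {ω | ω ∈ Aev s N hs1 K M₁ ω}) ≤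
      10 * Cg * s / M' := by
    have := key
    push_cast at this
    rw [pow_two]
    exact this.trans hrhs
  have hε2 : 0 < ε ^ 2 := by positivity
  have hmain : PG ≤ 10 * Cg * s / M' / ε ^ 2 := (le_div_iff₀' hε2).2 (e1.trans e2)
  calc PG ≤ 10 * Cg * s / M' / ε ^ 2 := hmain
    _ = 10 * Cg / ε ^ 2 * s / M' := by ring

end OneScale

/-! ### The multiscale sum -/

/-- Inner monotonicity of the arm event, weak form. [folklore] -/
theorem armEv_mono_inner' {k s N : ℕ} (hk : 1 ≤ k) (hks : k ≤ s) (hsN : s + 1 ≤ N) : armEv k N ⊆ armEv s N := by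
  rcases hks.eq_or_lt with rfl | hlt
  · exact subset_rfl
  · exact armEv_mono_inner hk hlt hsN

/-- **Choice of the numbers of stages and scales** making the failure probability of the good
event at most `1/6`. [folklore] -/
theorem exists_T_K {cq c₀ : ℝ} (hcq : 0 < cq) (hc₀ : 0 < c₀) (hc₀1 : c₀ ≤ 1) :
    ∃ T K : ℕ, 2 * (1 - cq) ^ T ≤ 1 / 12 ∧ 8 * T * (1 - c₀ ^ 4) ^ K ≤ 1 / 12 := by
  obtain ⟨T, hT⟩ := exists_pow_lt_of_lt_one (show (0 : ℝ) < 1 / 24 by norm_num) (show 1 - cq < 1 by linarith)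
  have hc4 : 0 < c₀ ^ 4 := by positivity
  have hc41 : c₀ ^ 4 ≤ 1 := pow_le_one₀ hc₀.le hc₀1
  obtain ⟨K, hK⟩ := exists_pow_lt_of_lt_one (show (0 : ℝ) < 1 / (96 * (T + 1)) by positivity)
    (show 1 - c₀ ^ 4 < 1 by linarith)
  refine ⟨T, K, by linarith, ?_⟩
  have hT0 : (0 : ℝ) ≤ T := by positivity
  have hpow0 : 0 ≤ (1 - c₀ ^ 4) ^ K := pow_nonneg (by linarith) K
  calc 8 * (T : ℝ) * (1 - c₀ ^ 4) ^ K ≤ 8 * T * (1 / (96 * (T + 1))) := by gcongr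
    _ = (8 * T) / (96 * (T + 1)) := by ring
    _ ≤ 1 / 12 := by
        rw [div_le_div_iff₀ (by positivity) (by norm_num)]
        nlinarith

/-- **Separation of the scales** `s_i = 3^i k₀ < s_j = 3^j k₀`: `2 s_i + A_j + 1 ≤ s_j`. [folklore] -/
theorem scales_sep {K k₀ i j : ℕ} (hk : 16 * radiiL K K ≤ k₀) (hij : i < j) :
    2 * (3 ^ i * k₀) + radiiA K K (3 ^ j * k₀) + 1 ≤ 3 ^ j * k₀ := by
  have hL0 : 0 < radiiL K K := by unfold radiiL; positivity
  have hk16 : 16 ≤ k₀ := by nlinarith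
  set t : ℕ := 3 ^ (j - 1) * k₀ with ht
  have h3 : 3 ^ j = 3 ^ (j - 1) * 3 := by rw [← pow_succ]; congr 1; omega
  have hsj : 3 ^ j * k₀ = 3 * t := by rw [h3, ht]; ring
  have hsi : 3 ^ i * k₀ ≤ t := Nat.mul_le_mul_right _ (Nat.pow_le_pow_right (by norm_num) (by omega))
  have ht16 : k₀ ≤ t := Nat.le_mul_of_pos_left _ (Nat.one_le_pow _ _ (by norm_num))
  have hscL : 16 * radiiL K K ≤ 3 ^ j * k₀ := hk.trans (Nat.le_mul_of_pos_left _ (Nat.one_le_pow _ _ (by norm_num)))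
  obtain ⟨-, -, -, -, -, h4A⟩ := radii_params hscL
  rw [hsj] at h4A ⊢
  omega

/-- **The two-arm probability of the U-shaped half-annulus at two radii**: there are `n₁` and
`C₁ ≥ 4` such that for all `k₀ ≥ n₁` and `M' ≥ 1`,
`P_{1/2}(open and closed inner–outer crossings of U_{k₀, 2M'}) ≤ C₁ k₀ / M'`
(Kesten's inner separation: first good scale among `s_j = 3^j k₀`, `MultiscaleSum.lean`). [cite: Nolin2008, Prop. 17 and Thm. 24 (i), §4.4–§4.6 (arXiv 0711.4948: Prop. 16, Thm. 23 (i))] [cite: KestenScalingCMP1987, Lemma 4] -/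
theorem real_armTwo_le : ∃ n₁ : ℕ, ∃ C₁ : ℝ, 1 ≤ n₁ ∧ 4 ≤ C₁ ∧ ∀ k₀ M' : ℕ, n₁ ≤ k₀ → 1 ≤ M' →
    (triSitePercolation half).real (armEv k₀ (2 * M') ∩ compl ⁻¹' armEv k₀ (2 * M')) ≤ C₁ * k₀ / M' := by
  classical
  obtain ⟨c₀, hc₀, hc₀1, hrsw⟩ := exists_rsw_long_half
  obtain ⟨cq, hcq, hq⟩ := real_uLRPath_half_le
  obtain ⟨Cg, hCg, hg⟩ := real_hpGood_le_div
  obtain ⟨T, K, hT, hK⟩ := exists_T_K hcq hc₀ hc₀1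
  set L := radiiL K K with hL
  have hL0 : 0 < L := by rw [hL]; unfold radiiL; positivity
  set cB : ℝ := ((c₀ ^ (6 * L - 1) * (1 / 2 : ℝ) ^ (6 * L - 1 - 1)) ^ 3) ^ 2 with hcB
  have hcB0 : 0 < cB := by positivity
  have hC0 : 0 ≤ 20 * Cg / cB := by positivity
  refine ⟨16 * L, 20 * Cg / cB + 4, by omega, by linarith, ?_⟩
  intro k₀ M' hk hM'
  have hk1 : 1 ≤ k₀ := by omega
  -- the number of scales
  have hex : ∃ j : ℕ, M' < 4 * (3 ^ j * k₀) :=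
    ⟨M', by have := Nat.lt_pow_self (by norm_num : 1 < 3) (n := M'); nlinarith⟩
  set J := Nat.find hex with hJ
  have hJspec : M' < 4 * (3 ^ J * k₀) := Nat.find_spec hex
  have hJmin : ∀ j < J, 4 * (3 ^ j * k₀) ≤ M' := fun j hj => not_lt.1 (Nat.find_min hex hj)
  -- the scales
  have hsc1 : ∀ j : ℕ, 1 ≤ 3 ^ j * k₀ := fun j =>
    le_trans hk1 (Nat.le_mul_of_pos_left _ (Nat.one_le_pow _ _ (by norm_num)))
  have hscL : ∀ j : ℕ, 16 * L ≤ 3 ^ j * k₀ := fun j =>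
    hk.trans (Nat.le_mul_of_pos_left _ (Nat.one_le_pow _ _ (by norm_num)))
  set N := 2 * M' with hN
  -- the multiscale bound
  have hmain := real_le_sum_firstGood half (J := J)
    (E := armEv k₀ N ∩ compl ⁻¹' armEv k₀ N)
    (Es := fun j => armEv (3 ^ j * k₀) N ∩ compl ⁻¹' armEv (3 ^ j * k₀) N)
    (Gs := fun j => Gsc (3 ^ j * k₀) (hsc1 j) T K (radiiM₀ K K (3 ^ j * k₀)) K (radiiM₁ K K (3 ^ j * k₀)))
    (D := fun j => dFin (3 ^ j * k₀) N (radiiA K K (3 ^ j * k₀)))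
    (F := fun j => shellFin (3 ^ j * k₀) (radiiA K K (3 ^ j * k₀)))
    (fun j hj => by
      have hsN : 3 ^ j * k₀ + 1 ≤ N := by have := hJmin j hj; omega
      have hks : k₀ ≤ 3 ^ j * k₀ := Nat.le_mul_of_pos_left _ (Nat.one_le_pow _ _ (by norm_num))
      exact inter_subset_inter (armEv_mono_inner' hk1 hks hsN) (preimage_mono (armEv_mono_inner' hk1 hks hsN)))
    (fun j _ => determinedBy_armTwo_gsc (hsc1 j) le_rfl)
    (fun j _ => by rw [coe_shellFin (hsc1 j)]; exact determinedBy_gsc le_rfl)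
    (fun i j hij _ => disjoint_shellFin_shellFin (hsc1 i) (hsc1 j) (scales_sep hk hij))
    (fun i j hij _ => disjoint_shellFin_dFin (hsc1 i) (hsc1 j) (scales_sep hk hij))
  -- the pieces
  have hGc : ∀ i : ℕ, (sitePercolation (Site 2) half).real
      (Gsc (3 ^ i * k₀) (hsc1 i) T K (radiiM₀ K K (3 ^ i * k₀)) K (radiiM₁ K K (3 ^ i * k₀)))ᶜ ≤ 1 / 6 := by
    intro i
    have := real_compl_gsc_le (T := T) (hsc1 i) (hscL i) hc₀ hc₀1 hrsw hq hT hK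
    unfold triSitePercolation at this
    exact this
  have hprod : ∀ j : ℕ, ∏ i ∈ Finset.range j, (sitePercolation (Site 2) half).real
      (Gsc (3 ^ i * k₀) (hsc1 i) T K (radiiM₀ K K (3 ^ i * k₀)) K (radiiM₁ K K (3 ^ i * k₀)))ᶜ ≤ (1 / 6 : ℝ) ^ j := by
    intro j
    calc ∏ i ∈ Finset.range j, (sitePercolation (Site 2) half).real
          (Gsc (3 ^ i * k₀) (hsc1 i) T K (radiiM₀ K K (3 ^ i * k₀)) K (radiiM₁ K K (3 ^ i * k₀)))ᶜ
        ≤ ∏ _i ∈ Finset.range j, (1 / 6 : ℝ) := Finset.prod_le_prod (fun _ _ => measureReal_nonneg) fun i _ => hGc i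
      _ = (1 / 6 : ℝ) ^ j := by rw [Finset.prod_const, Finset.card_range]
  have hEs : ∀ j < J, (sitePercolation (Site 2) half).real
      ((armEv (3 ^ j * k₀) N ∩ compl ⁻¹' armEv (3 ^ j * k₀) N) ∩
        Gsc (3 ^ j * k₀) (hsc1 j) T K (radiiM₀ K K (3 ^ j * k₀)) K (radiiM₁ K K (3 ^ j * k₀))) ≤
      10 * Cg / cB * (3 ^ j * k₀ : ℕ) / M' := by
    intro j hj
    have := real_armTwo_gsc_le (T := T) (hsc1 j) (hscL j) hN (hJmin j hj) hc₀ hrsw hg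
    unfold triSitePercolation at this
    rw [← hL] at this
    exact this
  -- the geometric tail
  have hM'0 : (0 : ℝ) < M' := by exact_mod_cast hM'
  have hk0 : (0 : ℝ) < k₀ := by exact_mod_cast hk1
  have htail : (1 / 6 : ℝ) ^ J ≤ 4 * k₀ / M' := by
    have h1 : (1 / 6 : ℝ) ^ J ≤ (1 / 3 : ℝ) ^ J := pow_le_pow_left₀ (by norm_num) (by norm_num) J
    have h2 : (M' : ℝ) < 4 * (3 ^ J * k₀) := by exact_mod_cast hJspec
    have h3 : (1 / 3 : ℝ) ^ J * 3 ^ J = 1 := by rw [← mul_pow]; norm_num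
    rw [le_div_iff₀ hM'0]
    calc (1 / 6 : ℝ) ^ J * M' ≤ (1 / 3 : ℝ) ^ J * M' := by gcongr
      _ ≤ (1 / 3 : ℝ) ^ J * (4 * (3 ^ J * k₀)) := by gcongr
      _ = 4 * k₀ * ((1 / 3 : ℝ) ^ J * 3 ^ J) := by ring
      _ = 4 * k₀ := by rw [h3, mul_one]
  -- the sum
  have hterm : ∀ j ∈ Finset.range J, (sitePercolation (Site 2) half).real
      ((armEv (3 ^ j * k₀) N ∩ compl ⁻¹' armEv (3 ^ j * k₀) N) ∩
        Gsc (3 ^ j * k₀) (hsc1 j) T K (radiiM₀ K K (3 ^ j * k₀)) K (radiiM₁ K K (3 ^ j * k₀))) *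
      ∏ i ∈ Finset.range j, (sitePercolation (Site 2) half).real
        (Gsc (3 ^ i * k₀) (hsc1 i) T K (radiiM₀ K K (3 ^ i * k₀)) K (radiiM₁ K K (3 ^ i * k₀)))ᶜ ≤
      (10 * Cg / cB * k₀ / M') * (1 / 2 : ℝ) ^ j := by
    intro j hj
    have hjJ := Finset.mem_range.1 hj
    have e : (10 * Cg / cB * (3 ^ j * k₀ : ℕ) / M') * (1 / 6 : ℝ) ^ j = (10 * Cg / cB * k₀ / M') * (1 / 2 : ℝ) ^ j := by
      have : ((3 : ℝ) ^ j) * (1 / 6 : ℝ) ^ j = (1 / 2 : ℝ) ^ j := by rw [← mul_pow]; norm_num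
      push_cast
      rw [← this]
      ring
    rw [← e]
    exact mul_le_mul (hEs j hjJ) (hprod j) (Finset.prod_nonneg fun _ _ => measureReal_nonneg)
      (by positivity)
  unfold triSitePercolation
  calc (sitePercolation (Site 2) half).real (armEv k₀ N ∩ compl ⁻¹' armEv k₀ N)
      ≤ _ := hmain
    _ ≤ ∑ j ∈ Finset.range J, (10 * Cg / cB * k₀ / M') * (1 / 2 : ℝ) ^ j + (1 / 6 : ℝ) ^ J :=
        add_le_add (Finset.sum_le_sum hterm) (hprod J)
    _ = (10 * Cg / cB * k₀ / M') * ∑ j ∈ Finset.range J, (1 / 2 : ℝ) ^ j + (1 / 6 : ℝ) ^ J := by rw [Finset.mul_sum]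
    _ ≤ (10 * Cg / cB * k₀ / M') * 2 + 4 * k₀ / M' := by
        have hc : 0 ≤ 10 * Cg / cB * k₀ / M' := by positivity
        exact add_le_add (mul_le_mul_of_nonneg_left (sum_geometric_two_le J) hc) htail
    _ = (20 * Cg / cB + 4) * k₀ / M' := by ring

/-! ### The discharge -/

/-- **crit-perc.S16, half-plane two-arm probability at two radii** (discharge of
`Nolin2008_halfPlane_twoArm`): for `p = 1/2` and every colour sequence `κ` of length `2` there are
`n₀, C` with `P(Π_κ(m, n) in the upper half-plane) ≤ C m / n` for `n₀ ≤ m ≤ n`. Proof: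
colour switching and restriction to the U-shaped half-annulus (`real_domArmEvent_two_le`), then
`real_armTwo_le`. [cite: Nolin2008, Thm. 24 (i) with Prop. 17 and §4.6 (arXiv 0711.4948: Thm. 23 (i), Prop. 16)] [cite: WernerPCMI2009, Lecture 2, first exercise sheet ("Two-arm exponent in the half-plane", 3)] [cite: SmirnovWernerMRL2001, Thm. 3 (half-plane exponents)] -/
theorem Nolin2008_halfPlane_twoArm_holds : Nolin2008_halfPlane_twoArm := by
  obtain ⟨n₁, C₁, hn₁, hC₁, hmain⟩ := real_armTwo_le
  refine ⟨n₁, 16 * C₁ + 11, fun κ m n hm hmn => ?_⟩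
  have hm1 : 1 ≤ m := hn₁.trans hm
  have hm0 : (0 : ℝ) < m := by exact_mod_cast hm1
  have hn0 : (0 : ℝ) < n := by exact_mod_cast (hm1.trans hmn)
  have hP1 : (triSitePercolation half).real (domArmEvent κ m n upperHalfPlane) ≤ 1 := measureReal_le_one
  set M' : ℕ := (n - 1) / 4 with hM'
  by_cases hcase : 1 ≤ M' ∧ m + 3 ≤ 2 * M'
  · obtain ⟨hM'1, hmM⟩ := hcase
    have hNn : 2 * (2 * M') + 1 ≤ n := by omega
    have h1 := real_domArmEvent_two_le hm1 (N := 2 * M') (by omega) hNn κ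
    have h2 := hmain (m + 1) M' (by omega) hM'1
    have h8 : (n : ℝ) ≤ 8 * M' := by
      have : n ≤ 8 * M' := by omega
      exact_mod_cast this
    have hM'0 : (0 : ℝ) < M' := by exact_mod_cast hM'1
    calc (triSitePercolation half).real (domArmEvent κ m n upperHalfPlane)
        ≤ (triSitePercolation half).real (armEv (m + 1) (2 * M') ∩ compl ⁻¹' armEv (m + 1) (2 * M')) := h1
      _ ≤ C₁ * (m + 1 : ℕ) / M' := h2
      _ ≤ (16 * C₁ + 11) * (m / n) := by
          push_cast
          rw [div_le_iff₀ hM'0]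
          have hC0 : 0 ≤ C₁ := by linarith
          have hmn' : (m : ℝ) / 8 ≤ (m : ℝ) / n * M' := by
            rw [div_le_iff₀ (by norm_num : (0:ℝ) < 8)]
            calc (m : ℝ) = m / n * n := by field_simp
              _ ≤ m / n * (8 * M') := by gcongr
              _ = m / n * M' * 8 := by ring
          have e1 : (16 * C₁ + 11) * ((m : ℝ) / 8) ≤ (16 * C₁ + 11) * ((m : ℝ) / n * M') :=
            mul_le_mul_of_nonneg_left hmn' (by linarith)
          have e2 : C₁ * 1 ≤ C₁ * m := mul_le_mul_of_nonneg_left (by exact_mod_cast hm1) hC0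
          have hm1' : (1 : ℝ) ≤ m := by exact_mod_cast hm1
          nlinarith [e1, e2, hm1', hC0]
  · -- degenerate: `n ≤ 2m + 9`, the bound exceeds `1`
    have hn : n ≤ 2 * m + 9 := by omega
    have hn' : (n : ℝ) ≤ 2 * m + 9 := by exact_mod_cast hn
    have hC0 : 0 ≤ C₁ := by linarith
    have hCm : 0 ≤ C₁ * m := mul_nonneg hC0 hm0.le
    have hm1' : (1 : ℝ) ≤ m := by exact_mod_cast hm1
    calc (triSitePercolation half).real (domArmEvent κ m n upperHalfPlane) ≤ 1 := hP1
      _ ≤ (16 * C₁ + 11) * (m / n) := by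
          rw [mul_div_assoc', le_div_iff₀ hn0]
          nlinarith [hCm, hm1', hn']

end Literature.Probability.Percolation
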